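import Summits.CriticalPhenomena.PercolationContinuityZ3.Theorems.Transplant.Bcc111FilmHexShadow
import Summits.CriticalPhenomena.PercolationContinuityZ3.Theorems.Transplant.HexShadowVRoutingR
import Summits.CriticalPhenomena.PercolationContinuityZ3.Theorems.Transplant.HexShadowVFromLocal
import Summits.CriticalPhenomena.PercolationContinuityZ3.Theorems.Transplant.HexShadowInjective
import Summits.CriticalPhenomena.PercolationContinuityZ3.Theorems.Transplant.BccSkeletonConc
import HarnessLib

/-!
# The bcc (111)-FILMS AT THEIR OWN CRITICAL POINT, p205010-free: connectedness, Burton–Keane scope, and **`θ_{F_m(bcc)}(v, p_c) = 0` modulo the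
# hexagonal routing node `ShapedLinkage R`** (every `m ≥ 1`), OUTRIGHT for the thin films `m ≤ 2`

builds on p205010 (kernel theorem, internal audit signed; external expert review pending) — NOT used in this file.
Lane `prim-bschramm`, seat `prim-bschramm-p2` (gen 47; class C1b = films / other 3D lattices at their own critical point, METHOD = input
substitution; memo `HOME/bschramm/P2-LATTICES.md` §158); helper file (`--supports stmt-CriticalPhenomena-4575 --as helper`).
The instance «Bcc111FilmHexShadow».`Bcc111.hexShadow m` feeds the generic hexagonal Duminil-Copin–Sidoravicius–Tassion layer: eq. (1), Lemmata 4–5, eqs. (10)–(13),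
§2.2, the finite-size criterion and Fact 1 are PROVED in the tree for every hexagonal shadow («HexShadow*»); the gluing Lemma 6 follows from the instance's routing
certificate `ShapedLinkage R` («HexShadowVRoutingR».`hexGluing_of_shapedLinkageR`) — or is vacuous when the shadow is injective («HexShadowInjective»).
What this file supplies is the SCOPE: the film is connected for `m ≥ 1` (§1: every vertex descends to level `0` along `(−1,−1,1)`; the level-`0` layer, the
triangular lattice `{(2p, 2q, −2p−2q)}`, is linked through level `1`) and amenable quasi-transitive (§2: the lifted translations have finitely many orbits, balls
grow cubically), so Burton–Keane gives a.s. uniqueness of the infinite cluster at every density.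
* §3 **`Bcc111.theta_criticalProb_eq_zero_of_shapedLinkage`** (`m ≥ 1`, any `R ≥ 1`): `(hexShadow m).ShapedLinkage R → ∀ v, θ_{F_m(bcc)}(v, p_c) = 0`;
  `…_of_localLinkage`; **`Bcc111.theta_criticalProb_eq_zero_of_le_two`**: `θ_{F_m(bcc)}(v, p_c) = 0` UNCONDITIONALLY for `m = 1, 2` (injective shadow: `F_1(bcc)`
  is the honeycomb lattice, `F_2(bcc)` the dice lattice).  The FAT films `m ≥ 3` (in-column elevators `(x, x+(1,1,1))`) await their routing certificate.
[cite: DuminilCopinSidoraviciusTassion2016, Thm. 1 and §2.3] [cite: BenjaminiSchramm1996, Conj. 4 / Question 3] [cite: ConwaySloane1999, Ch. 4 §7.1]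
[cite: BurtonKeane1989, Thm. 2] [cite: LyonsPeres2016, §7.4 and Thm. 7.6]
-/

noncomputable section

namespace Summit.CriticalPhenomena.PercolationContinuityZ3.Theorems.Transplant

namespace Bcc111

open MeasureTheory Literature.Probability.Percolation Literature.Probability.LatticeModels SimpleGraph Filter
open Slab111 (lev lev_add)
open BccConc (add_mem_bccSite bccGraph_adj_addUnit)
open Literature.Barriers.CriticalPhenomena (IsQuasiTransitive IsGraphAmenable HasExponentialGrowth graphBall ballVolume graphBall_finite
  hasExponentialGrowth_of_not_isGraphAmenable BurtonKeane1989_atMostOneInfiniteCluster_holds)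
open scoped Classical

variable {m : ℕ}

/-! ## §1 Connectedness (`m ≥ 1`) -/

/-- **A unit bond inside the film**: if `x + d` (`d ∈ {±1}³`) has level in `[0, m]`, it is a film neighbour of `x`. [cite: ConwaySloane1999, Ch. 4 §7.1] -/
theorem exists_adj_add (x : bfilm m) (d : Site 3) (hd : ∀ i, d i = 1 ∨ d i = -1) (h0 : 0 ≤ lev (pt x + d)) (hm : lev (pt x + d) ≤ m) :
    ∃ y : bfilm m, pt y = pt x + d ∧ (film m).Adj x y := by
  refine ⟨⟨⟨pt x + d, add_mem_bccSite (x : bccSite).2 hd⟩, ⟨h0, hm⟩⟩, rfl, ?_⟩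
  exact bccGraph_adj_addUnit (x : bccSite) hd

/-- The level of `x + d`. [folklore] -/
theorem lev_add_vec (x d : Site 3) : lev (x + d) = lev x + (d 0 + d 1 + d 2) := by
  simp only [lev, Pi.add_apply]; ring

/-- Reachability from an adjacency with prescribed coordinates. [folklore] -/
theorem reachable_of_adj {x y : bfilm m} (h : (film m).Adj x y) : (film m).Reachable x y := h.reachable

/-- **Every film vertex is joined to a vertex of level `0`** (descend along `(−1,−1,1)`). [cite: ConwaySloane1999, Ch. 4 §7.1] -/
theorem reachable_level_zero (x : bfilm m) : ∃ y : bfilm m, lev (pt y) = 0 ∧ (film m).Reachable x y := by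
  have hx : 0 ≤ lev (pt x) ∧ lev (pt x) ≤ m := x.2
  obtain ⟨n, hn⟩ : ∃ n : ℕ, lev (pt x) = n := ⟨(lev (pt x)).toNat, (Int.toNat_of_nonneg hx.1).symm⟩
  induction n generalizing x with
  | zero => exact ⟨x, by simpa using hn, Reachable.refl x⟩
  | succ n ih =>
    have hlev : lev (pt x + ![-1, -1, 1]) = n := by rw [lev_add_vec, hn]; simp
    have hnm : (n : ℤ) ≤ m := by have := hx.2; rw [hn] at this; push_cast at this; omega
    obtain ⟨y, hy, hadj⟩ := exists_adj_add x ![-1, -1, 1] (fun i => by fin_cases i <;> simp) (by rw [hlev]; positivity) (by rw [hlev]; exact hnm)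
    have hylev : lev (pt y) = n := by rw [hy, hlev]
    obtain ⟨z, hz, hyz⟩ := ih y y.2 hylev
    exact ⟨z, hz, hadj.reachable.trans hyz⟩

/-- **A two-step move inside the levels `0, 1`**: from a level-`0` vertex `x`, up along `u` and down along `d` (`u, d ∈ {±1}³`, `lev u = 1`, `lev d = −1`) to the
level-`0` vertex `x + u + d` (`m ≥ 1`). [cite: ConwaySloane1999, Ch. 4 §7.1] -/
theorem reachable_two_step (hm : 1 ≤ m) (x : bfilm m) (hx : lev (pt x) = 0) (u d : Site 3) (hu : ∀ i, u i = 1 ∨ u i = -1) (hd : ∀ i, d i = 1 ∨ d i = -1)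
    (hlu : u 0 + u 1 + u 2 = 1) (hld : d 0 + d 1 + d 2 = -1) :
    ∃ y : bfilm m, pt y = pt x + u + d ∧ lev (pt y) = 0 ∧ (film m).Reachable x y := by
  have hm' : (1 : ℤ) ≤ m := by exact_mod_cast hm
  have h1 : lev (pt x + u) = 1 := by rw [lev_add_vec, hx, hlu]; ring
  obtain ⟨y, hy, hxy⟩ := exists_adj_add x u hu (by rw [h1]; norm_num) (by rw [h1]; exact hm')
  have h2 : lev (pt y + d) = 0 := by rw [lev_add_vec, hy, h1, hld]; ring
  obtain ⟨z, hz, hyz⟩ := exists_adj_add y d hd (by rw [h2]) (by rw [h2]; positivity)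
  exact ⟨z, by rw [hz, hy], by rw [hz, h2], hxy.reachable.trans hyz.reachable⟩

/-- A level-`0` bcc site has even coordinates and `x₂ = −x₀ − x₁`. [folklore] -/
theorem even_of_lev_zero (x : bfilm m) (hx : lev (pt x) = 0) : ∃ p q : ℤ, pt x 0 = 2 * p ∧ pt x 1 = 2 * q ∧ pt x 2 = -2 * p - 2 * q := by
  have hl : pt x 0 + pt x 1 + pt x 2 = 0 := hx
  rcases (mem_bccSite_iff (pt x)).1 (x : bccSite).2 with h | h
  · obtain ⟨p, hp⟩ := h 0
    obtain ⟨q, hq⟩ := h 1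
    exact ⟨p, q, by rw [hp]; ring, by rw [hq]; ring, by omega⟩
  · exfalso
    obtain ⟨a, ha⟩ := h 0; obtain ⟨b, hb⟩ := h 1; obtain ⟨c, hc⟩ := h 2
    omega

/-- The film vertex at the origin (level `0`; in the film for every `m`). [folklore] -/
def origin (m : ℕ) : bfilm m := ⟨bccOrigin, by refine ⟨?_, ?_⟩ <;> simp [lev, bccOrigin]⟩

/-- Coordinates of the origin. [folklore] -/
@[simp] theorem pt_origin (m : ℕ) : pt (origin m) = 0 := rfl

/-- **Every level-`0` vertex is joined to the origin** (`m ≥ 1`): the level-`0` layer is `{(2p, 2q, −2p−2q)}`, and the moves `±(2,0,−2)`, `±(0,2,−2)` are two-step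
paths through level `1`; induction on `|p| + |q|`. [cite: ConwaySloane1999, Ch. 4 §7.1] -/
theorem reachable_origin_of_lev_zero (hm : 1 ≤ m) : ∀ (n : ℕ) (x : bfilm m), lev (pt x) = 0 → (pt x 0).natAbs + (pt x 1).natAbs ≤ n →
    (film m).Reachable x (origin m) := by
  intro n
  induction n with
  | zero =>
    intro x hx hn
    obtain ⟨p, q, h0, h1, h2⟩ := even_of_lev_zero x hx
    have hp : pt x 0 = 0 := by omega
    have hq : pt x 1 = 0 := by omega
    have : x = origin m := by
      apply Subtype.ext; apply Subtype.ext; ext i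
      fin_cases i
      · simpa using hp
      · simpa using hq
      · show pt x 2 = (0 : Site 3) 2; simp; omega
    rw [this]
  | succ n ih =>
    intro x hx hn
    obtain ⟨p, q, h0, h1, h2⟩ := even_of_lev_zero x hx
    by_cases hpq : (pt x 0).natAbs + (pt x 1).natAbs ≤ n
    · exact ih x hx hpq
    -- one two-step move decreasing `|x₀| + |x₁|` by `2`
    have key : ∀ (u d : Site 3), (∀ i, u i = 1 ∨ u i = -1) → (∀ i, d i = 1 ∨ d i = -1) → u 0 + u 1 + u 2 = 1 → d 0 + d 1 + d 2 = -1 →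
        (pt x 0 + u 0 + d 0).natAbs + (pt x 1 + u 1 + d 1).natAbs ≤ n → (film m).Reachable x (origin m) := by
      intro u d hu hd hlu hld hdec
      obtain ⟨y, hy, hy0, hxy⟩ := reachable_two_step hm x hx u d hu hd hlu hld
      refine hxy.trans (ih y hy0 ?_)
      rw [hy]; simpa [Pi.add_apply] using hdec
    rcases lt_trichotomy p 0 with hp | hp | hp
    · -- move `(+2, 0, −2)` = `(1,1,−1) + (1,−1,−1)`
      refine key ![1, 1, -1] ![1, -1, -1] (fun i => by fin_cases i <;> simp) (fun i => by fin_cases i <;> simp) (by simp) (by simp) ?_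
      simp; omega
    · rcases lt_trichotomy q 0 with hq | hq | hq
      · -- move `(0, +2, −2)` = `(1,1,−1) + (−1,1,−1)`
        refine key ![1, 1, -1] ![-1, 1, -1] (fun i => by fin_cases i <;> simp) (fun i => by fin_cases i <;> simp) (by simp) (by simp) ?_
        simp; omega
      · exfalso; apply hpq; rw [h0, h1, hp, hq]; simp
      · -- move `(0, −2, +2)` = `(1,−1,1) + (−1,−1,1)`
        refine key ![1, -1, 1] ![-1, -1, 1] (fun i => by fin_cases i <;> simp) (fun i => by fin_cases i <;> simp) (by simp) (by simp) ?_
        simp; omega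
    · -- move `(−2, 0, +2)` = `(−1,1,1) + (−1,−1,1)`
      refine key ![-1, 1, 1] ![-1, -1, 1] (fun i => by fin_cases i <;> simp) (fun i => by fin_cases i <;> simp) (by simp) (by simp) ?_
      simp; omega

/-- **The bcc (111)-film is connected for `m ≥ 1`.** [cite: ConwaySloane1999, Ch. 4 §7.1] -/
theorem connected (hm : 1 ≤ m) : (film m).Connected := by
  haveI : Nonempty (bfilm m) := ⟨origin m⟩
  refine Connected.mk fun x y => ?_
  obtain ⟨x₀, hx₀, hx⟩ := reachable_level_zero x
  obtain ⟨y₀, hy₀, hy⟩ := reachable_level_zero y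
  have hx' := reachable_origin_of_lev_zero hm _ x₀ hx₀ le_rfl
  have hy' := reachable_origin_of_lev_zero hm _ y₀ hy₀ le_rfl
  exact (hx.trans hx').trans (hy.trans hy').symm

/-! ## §2 Scope for Burton–Keane: quasi-transitivity, cubic growth, amenability, uniqueness -/

/-- The representatives of the translation orbits: vertices with shadow in `{0,1,2}²` (nine finite columns). [folklore] -/
theorem finite_reps (m : ℕ) : {x : bfilm m | (0 ≤ sh x 0 ∧ sh x 0 ≤ 2) ∧ (0 ≤ sh x 1 ∧ sh x 1 ≤ 2)}.Finite := by
  have hsub : {x : bfilm m | (0 ≤ sh x 0 ∧ sh x 0 ≤ 2) ∧ (0 ≤ sh x 1 ∧ sh x 1 ≤ 2)} ⊆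
      ⋃ z ∈ ((fun pq : ℤ × ℤ => (![pq.1, pq.2] : Site 2)) '' (Set.Icc (0 : ℤ) 2 ×ˢ Set.Icc (0 : ℤ) 2)), {x : bfilm m | sh x = z} := by
    intro x hx
    obtain ⟨h0, h1⟩ := hx
    simp only [Set.mem_iUnion, Set.mem_setOf_eq, exists_prop, Set.mem_image, Set.mem_prod, Set.mem_Icc]
    refine ⟨![sh x 0, sh x 1], ⟨(sh x 0, sh x 1), ⟨h0, h1⟩, rfl⟩, ?_⟩
    ext i; fin_cases i <;> rfl
  refine Set.Finite.subset ?_ hsub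
  exact Set.Finite.biUnion (((Set.finite_Icc _ _).prod (Set.finite_Icc _ _)).image _) fun z _ => fibre_finite m z

/-- **The film is quasi-transitive** (the lifted translations by `3ℤ²` have finitely many orbits). [cite: LyonsPeres2016, §7.4] -/
theorem isQuasiTransitive (m : ℕ) : IsQuasiTransitive (bccGraph.induce (bfilm m)) := by
  refine ⟨(finite_reps m).toFinset, fun x => ?_⟩
  set q0 : ℤ := sh x 0 / 3 with hq0
  set q1 : ℤ := sh x 1 / 3 with hq1
  refine ⟨shiftIso m ![-q0, -q1], ?_⟩
  rw [Set.Finite.mem_toFinset, Set.mem_setOf_eq, sh_shiftIso]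
  simp only [Pi.add_apply, Pi.smul_apply, smul_eq_mul, Matrix.cons_val_zero, Matrix.cons_val_one]
  omega

/-- Along a film bond each shadow coordinate moves by at most one. [folklore] -/
theorem abs_sh_sub_le_one {x y : bfilm m} (h : (film m).Adj x y) (i : Fin 2) : |sh x i - sh y i| ≤ 1 := by
  have ht := triNorm_sh_sub_le_one h
  have hb := abs_le_triNorm (sh x - sh y)
  fin_cases i
  · exact le_trans (by simpa using hb.1) ht
  · exact le_trans (by simpa using hb.2) ht

/-- Along a walk of length `n` the shadow coordinates move by at most `n`. [folklore] -/
theorem abs_sh_sub_le_length {x y : bfilm m} (w : (film m).Walk x y) (i : Fin 2) : |sh y i - sh x i| ≤ (w.length : ℤ) := by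
  induction w with
  | nil => simp
  | @cons a b c hab w ih =>
    have h1 : |sh b i - sh a i| ≤ 1 := by rw [abs_sub_comm]; exact abs_sh_sub_le_one hab i
    have h2 : |sh c i - sh a i| ≤ |sh c i - sh b i| + |sh b i - sh a i| := abs_sub_le _ _ _
    simp only [SimpleGraph.Walk.length_cons, Nat.cast_add, Nat.cast_one]
    linarith

/-- **Cubic volume growth**: `|B(x,n)| ≤ (2n+1)²·(m+1)`. [cite: LyonsPeres2016, §6.1 (growth of balls)] -/
theorem ballVolume_le (x : bfilm m) (n : ℕ) : ballVolume (film m) x n ≤ (2 * n + 1) ^ 2 * (m + 1) := by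
  set f : bfilm m → ℤ × ℤ × ℤ := fun y => (sh y 0 - sh x 0, sh y 1 - sh x 1, lev (pt y)) with hf
  have hinj : Function.Injective f := by
    intro y z h
    simp only [hf, Prod.mk.injEq] at h
    refine eq_of_sh_eq_of_lev_eq ?_ h.2.2
    ext i; fin_cases i
    · show sh y 0 = sh z 0; omega
    · show sh y 1 = sh z 1; omega
  set S : Finset (ℤ × ℤ × ℤ) := Finset.Icc (-(n : ℤ)) n ×ˢ (Finset.Icc (-(n : ℤ)) n ×ˢ Finset.Icc (0 : ℤ) m) with hS
  have hsub : f '' graphBall (film m) x n ⊆ ↑S := by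
    rintro _ ⟨y, ⟨w, hw⟩, rfl⟩
    have h0 := abs_sh_sub_le_length w 0
    have h1 := abs_sh_sub_le_length w 1
    have hn : (w.length : ℤ) ≤ n := by exact_mod_cast hw
    obtain ⟨h3, h4⟩ := y.2
    rw [abs_le] at h0 h1
    simp only [hS, hf, Finset.coe_product, Finset.coe_Icc, Set.mem_prod, Set.mem_Icc]
    refine ⟨⟨?_, ?_⟩, ⟨?_, ?_⟩, h3, h4⟩ <;> linarith
  have hcard : S.card = (2 * n + 1) ^ 2 * (m + 1) := by
    rw [hS, Finset.card_product, Finset.card_product, Int.card_Icc, Int.card_Icc]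
    have e1 : ((n : ℤ) + 1 - -(n : ℤ)).toNat = 2 * n + 1 := by omega
    have e2 : ((m : ℤ) + 1 - 0).toNat = m + 1 := by omega
    rw [e1, e2]; ring
  unfold ballVolume
  rw [← Set.ncard_image_of_injective _ hinj, ← hcard, ← Set.ncard_coe_finset]
  exact Set.ncard_le_ncard hsub S.finite_toSet

/-- The film does not have exponential growth. [cite: Hutchcroft2016, §1 (exponential growth)] -/
theorem not_hasExponentialGrowth (m : ℕ) : ¬ HasExponentialGrowth (bccGraph.induce (bfilm m)) := by
  intro h
  obtain ⟨c, hc, hev⟩ := h (origin m)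
  have hev2 := Literature.Barriers.CriticalPhenomena.eventually_pow_lt_const_pow 3 hc
  obtain ⟨n, ⟨hn1, hn2⟩, hnk⟩ := ((hev.and hev2).and (eventually_ge_atTop m)).exists
  have hvol : (ballVolume (film m) (origin m) n : ℝ) ≤ (2 * n + 1) ^ 2 * (m + 1) := by
    exact_mod_cast ballVolume_le (origin m) n
  have hk' : ((m : ℝ) + 1) ≤ 2 * n + 1 := by
    have : (m : ℝ) ≤ n := by exact_mod_cast hnk
    linarith
  have hle : ((2 * n + 1 : ℝ)) ^ 2 * (m + 1) ≤ (2 * n + 1) ^ 3 := by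
    rw [pow_succ]
    exact mul_le_mul_of_nonneg_left hk' (sq_nonneg _)
  linarith

/-- **The film is amenable** (subexponential growth + quasi-transitivity). [cite: LyonsPeres2016, §6.1 (p. 279)] -/
theorem isGraphAmenable (m : ℕ) : IsGraphAmenable (bccGraph.induce (bfilm m)) := by
  by_contra h
  exact not_hasExponentialGrowth m (hasExponentialGrowth_of_not_isGraphAmenable _ (isQuasiTransitive m) h)

/-- **Uniqueness of the infinite cluster on the bcc (111)-film, every density** (`m ≥ 1`; Burton–Keane for amenable quasi-transitive connected graphs).
[cite: BurtonKeane1989, Thm. 2] [cite: LyonsPeres2016, Thm. 7.6] -/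
theorem numInfiniteClusters_le_one (hm : 1 ≤ m) (p : unitInterval) : ∀ᵐ ω ∂(bondPercolation (film m) p), numInfiniteClusters ω ≤ 1 :=
  BurtonKeane1989_atMostOneInfiniteCluster_holds _ (connected hm) (isQuasiTransitive m) (isGraphAmenable m) p

/-! ## §3 The films at their own critical point -/

/-- **`θ_{F_m(bcc)}(v, p_c(F_m(bcc))) = 0` FROM THE ROUTING CERTIFICATE `ShapedLinkage R`** (every `m ≥ 1`, any surgery radius `R ≥ 1`) — p205010-free: the
hexagonal DST layer «HexShadow*» (eq. (1), Lemmata 4–5, (10)–(13), §2.2, the criterion, Fact 1 proved generically), the located surgeries from the swap pairs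
(«HexShadowVRoutingR»), Burton–Keane (§2) and connectedness (§1).  The certificate is the ONE remaining node of the bcc (111) row for `m ≥ 3`.
[cite: DuminilCopinSidoraviciusTassion2016, Thm. 1 and §2.3] [cite: BenjaminiSchramm1996, Conj. 4 / Question 3] -/
theorem theta_criticalProb_eq_zero_of_shapedLinkage (hm : 1 ≤ m) {R : ℕ} (hR : 1 ≤ R) (hL : (hexShadow m).ShapedLinkage R) (v : bfilm m) :
    theta (film m) v (criticalProbIOf (film m) v) = 0 :=
  (hexShadow m).theta_criticalProb_eq_zero_of_hexGluing (connected hm) (numInfiniteClusters_le_one hm) ((hexShadow m).hexGluing_of_shapedLinkageR hL hR) v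

/-- **`θ_{F_m(bcc)}(v, p_c) = 0` from the vertex node `LocalLinkage`** (every `m ≥ 1`; via `ShapedLinkage 3`). [cite: DuminilCopinSidoraviciusTassion2016, Thm. 1 and §2.3] -/
theorem theta_criticalProb_eq_zero_of_localLinkage (hm : 1 ≤ m) (hL : (hexShadow m).LocalLinkage) (v : bfilm m) :
    theta (film m) v (criticalProbIOf (film m) v) = 0 :=
  theta_criticalProb_eq_zero_of_shapedLinkage hm (by norm_num : (1 : ℕ) ≤ 3) ((hexShadow m).shapedLinkage_of_localLinkage hL) v

/-- **THE THIN bcc (111)-FILMS `m = 1, 2` DIE AT THEIR OWN CRITICAL POINT — UNCONDITIONAL**, p205010-free: the shadow is injective («Bcc111FilmHexShadow».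
`sh_injective_of_le_two`), so DST's located surgeries are vacuous («HexShadowInjective»).  (`F_1(bcc)` is the honeycomb lattice, `F_2(bcc)` the dice lattice — the
`(111)`-films of `ℤ³` of thickness `1, 2`, rows already p205010-free; this is the bcc-coordinate form.)
[cite: DuminilCopinSidoraviciusTassion2016, Thm. 1] [cite: BenjaminiSchramm1996, Conj. 4 / Question 3] -/
theorem theta_criticalProb_eq_zero_of_le_two (hm : 1 ≤ m) (hm2 : m ≤ 2) (v : bfilm m) : theta (film m) v (criticalProbIOf (film m) v) = 0 :=
  (hexShadow m).theta_criticalProb_eq_zero_of_injective (connected hm) (numInfiniteClusters_le_one hm) (sh_injective_of_le_two hm2) v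

end Bcc111

end Summit.CriticalPhenomena.PercolationContinuityZ3.Theorems.Transplant

end
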